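/-
Copyright (c) 2026 the pub-hodgecm-mathlib formalisation cell (harness21).  Prover seat hodgecm-mathlib-F0P3a-p05 (g18): road «S3-ram» (LEAD F0P3a-plan (g13); owner
F0P3a-p06 (g15∕g16); (Cnt2′) chair F0P3a-p07 (g14∕g15)), chair RULING (16)(b) «REGIME A-EVEN HYPERBOLIC, W-SIDE»: the kind counts in the pens' `GL` dress; 2026-09-02.
-/
import Literature.NumberTheory.Rogawski1990.DepthZeroKappaTransferTypeTwoRamifiedWSideLatticeCurrencyTopKinds   -- ★ p849359 (this seat) part XI: the three numbers in the local-datum dress `Γ = e₂γ₂`; brings part X (top ball empty)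
import Literature.NumberTheory.Automorphic.UnitaryLatticeTreeBlockRootRegionAxisTopClass                     -- ★ p849368 (this seat): `ncard_rootRegion_[not_]class_eq_ncard_two_of_top`; brings ★ p849253 (F0P3a-p01 (g18)) THM 1∕3
import Literature.NumberTheory.Rogawski1990.UnitaryVertexStabilizerCoverCM                                     -- ★ `isPrincipalIdealRing_integer_adicCompletion`
import HarnessLib

/-!
# The W-side lattice currency of the (T2) rows at a tame-ramified place, XII — part XI in the `GL` dress of the pens: for ANY `B₀ ∈ U(σ_w, !![0,1;1,0])`
# (`#{LEV(ϖ^d)} = q + 1`, `2·#{LEV(ϖ^d) ∧ [¬]CLS_d(c₀)} = q + 1` with the form `!![0,1;1,0]`, the element `B₀` and no `e₂`)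

Topic `NumberTheory/Rogawski1990`; namespace `Literature.NumberTheory.Automorphic.UnitaryGroup`.  THEOREMS ONLY (no definition, no instance, no notation, no named fact,
no `sorry`); kernel lane `--supports stmt-HodgeConjecture-24833`.  Cell `pub/hodgecm-mathlib` (D-0151), crux H413; road «S3-ram» (Literature seeding, count-neutral), (T2) G-side
organ (Cnt2′), route B, chair RULING (16)(b), regime **A-even** of the hyperbolic literal.  The route-B pens (A-p19 (g29), heir of F0P3a-p08 (g20)) work with the framed
block `B₀ = k⁻¹(s·ĝ_w)k ∈ U(σ_w, !![0,1;1,0])` as a bare `GL₂(L_w)` element, and this seat's ★ `ncard_rootRegion_[not_]class_eq_ncard_two_of_top` (generic `K`) delivers the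
junction-side kind counts as `W`-side counts in exactly that dress: `{B ∣ SD_{!![0,1;1,0]} B ∧ B₀·B = B ∧ ((B₀ − 1)B ⊆ ϖ^d₀B ∧ [¬]CLS^{!![0,1;1,0]}_(d₀)(c₀)(B))}`.  Part XI
(★ p849359) has the numbers in the local-datum dress `Γ = e₂γ₂`, `Φ₂ = placeForm`; this file restates them for ANY `B₀ ∈ U(σ_w, !![0,1;1,0])` (take `γ₂ := e₂⁻¹B₀`;
`placeForm Φ₂ w = !![0,1;1,0]` by ★ `placeForm_antidiagOne`, ★ `stdForm_antidiagonal_two_over_eq`), so that at `K = L_w` the composite «junction kind count = `(q+1)∕2`» is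
ONE `rw`:

* **`ncard_selfDual_fixed_lev_eq_of_top_of_mem_unitaryGroupOfForm`** — `#{B ∣ SD, B₀B = B, (B₀ − 1)B ⊆ ϖ^d B} = q + 1` (`d + 1 = 2n`, `|½tr B₀ − 1| ≤ |ϖ^d|`);
* **`two_mul_ncard_selfDual_fixed_lev_class_eq_of_top_of_mem_unitaryGroupOfForm`** — `2·#{… ∧ ((B₀ − 1)B ⊆ ϖ^d B ∧ CLS_d(c₀))} = q + 1` (`|½tr B₀ − 1| ≤ |ϖ^(d+1)|`, any unit `c₀`);
* **`two_mul_ncard_selfDual_fixed_lev_not_class_eq_of_top_of_mem_unitaryGroupOfForm`** — the `¬CLS_d(c₀)` twin.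
Hypotheses on `B₀`: no root of `χ_{B₀}` in `L_w`, `|tr² − 4det|(B₀) = exp(−2·2n)`, `n ≥ 1` — invariant under `U`-conjugation and unit scalars, so the pens discharge them from
`ĝ_w`'s (`tr(k⁻¹(sĝ)k) = s·tr ĝ`, `det = s²·det ĝ`).
HONEST LABEL: HC_CM is proved only modulo the 2 remaining named inputs (hLiu418 24832, h413 24833) until rung 0 closes; nothing printed is asserted here (currency bookkeeping over ★
results); «S3-ram» has no books consequence.

## References
* [LabesseLanglands1979] J.-P. Labesse, R. P. Langlands, *L-indistinguishability for SL(2)*, Canad. J. Math. 31 (1979): §2 Lemma 2.1 pp. 7–8.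
* [Kottwitz1986] R. E. Kottwitz, *Base change for unit elements of Hecke algebras*, Compositio Math. 60 (1986): §3.
* [Rogawski1990] J. D. Rogawski, *Automorphic Representations of Unitary Groups in Three Variables* (1990): §4.9 Lemma 4.9.3 p. 56.
-/

set_option autoImplicit false

noncomputable section

open MeasureTheory Measure Set NumberField IsDedekindDomain Matrix ValuativeRel MulAction Finset Polynomial
open scoped ValuativeRel Matrix MatrixGroups WithZero

namespace Literature.NumberTheory.Automorphic.UnitaryGroup

open Literature.NumberTheory.Rogawski1990 Literature.NumberTheory.Automorphic Literature.NumberTheory.Automorphic.IntegralReduction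
open Literature.GroupTheory Literature.NumberTheory.GaloisRepresentations
open Literature.NumberTheory.Automorphic.UnitaryLatticeTree Literature.NumberTheory.Automorphic.HermitianLattice

variable (L : Type) [Field L] [NumberField L] [IsCMField L] (v : HeightOneSpectrum (𝓞 ↥(maximalRealSubfield L)))
  (w : PlacesOver L v) (hw : IsCMField.complexConj L • w.1 = w.1)

/-! ## The three numbers of part XI for any `B₀ ∈ U(σ_w, !![0,1;1,0])` -/

set_option maxHeartbeats 1600000 in
-- budget only: statement-heavy CM-place tokens (two dresses).
include hw in
/-- **THE TOP REGION BALL HAS `q + 1` LATTICES (`GL` dress).**  For `B₀ ∈ U(σ_w, !![0,1;1,0])` with no root of `χ_{B₀}` in `L_w` and `|tr² − 4det|(B₀) = exp(−2·2n)` at a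
tame-ramified place, a level `d` with `d + 1 = 2n` and `|½tr B₀ − 1| ≤ |ϖ^d|`: `#{B ∣ SD_{!![0,1;1,0]} B, B₀B = B, (B₀ − 1)B ⊆ ϖ^d B} = q + 1` (★ part XI at `γ₂ := e₂⁻¹B₀`).
[cite: LabesseLanglands1979, §2 Lemma 2.1 p. 8] [cite: Kottwitz1986, §3] [cite: Rogawski1990, §4.9 Lemma 4.9.3 p. 56] -/
theorem ncard_selfDual_fixed_lev_eq_of_top_of_mem_unitaryGroupOfForm (he : v.asIdeal.ramificationIdx' w.1.asIdeal ≠ 1) (h2 : IsUnit (2 : 𝒪[(w.1.adicCompletion L)]))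
    (ϖ : (w.1.adicCompletion L)ˣ) (hϖ : Valued.v (ϖ : (w.1.adicCompletion L)) = WithZero.exp (-1 : ℤ))
    (hσϖ : (galAdicCompletionMap (L := L) (IsCMField.complexConj L) hw) (ϖ : (w.1.adicCompletion L)) = -(ϖ : (w.1.adicCompletion L)))
    (B₀ : GL (Fin 2) (w.1.adicCompletion L)) (hB₀ : B₀ ∈ unitaryGroupOfForm (galAdicCompletionMap (L := L) (IsCMField.complexConj L) hw) (!![(0 : (w.1.adicCompletion L)), 1; 1, 0] : Matrix (Fin 2) (Fin 2) (w.1.adicCompletion L)))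
    (hirr : ¬ ∃ x : (w.1.adicCompletion L), (((B₀ : Matrix (Fin 2) (Fin 2) (w.1.adicCompletion L))).charpoly).IsRoot x)
    {n : ℕ} (hN : Valued.v (((B₀ : Matrix (Fin 2) (Fin 2) (w.1.adicCompletion L))).trace ^ 2 - 4 * ((B₀ : Matrix (Fin 2) (Fin 2) (w.1.adicCompletion L))).det) = WithZero.exp (-((2 * (2 * n) : ℕ) : ℤ))) {d : ℕ} (hd : d + 1 = 2 * n)
    (hcD : Valued.v ((B₀ : Matrix (Fin 2) (Fin 2) (w.1.adicCompletion L)).trace / 2 - 1) ≤ Valued.v ((ϖ : (w.1.adicCompletion L)) ^ d)) :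
    {B : Submodule (Valued.integer (w.1.adicCompletion L)) (Fin 2 → (w.1.adicCompletion L)) | IsSelfDualLattice (galAdicCompletionMap (L := L) (IsCMField.complexConj L) hw) (ϖ : (w.1.adicCompletion L)) (!![(0 : (w.1.adicCompletion L)), 1; 1, 0] : Matrix (Fin 2) (Fin 2) (w.1.adicCompletion L)) B ∧ mapGL B₀ B = B ∧ B.map ((Matrix.toLin' ((B₀ : Matrix (Fin 2) (Fin 2) (w.1.adicCompletion L)) - 1)).restrictScalars (Valued.integer (w.1.adicCompletion L))) ≤ scaleLattice ((ϖ : (w.1.adicCompletion L)) ^ d) B}.ncard = (Nat.card (𝓞 ↥(maximalRealSubfield L) ⧸ v.asIdeal)) + 1 := by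
  have hH : (!![(0 : (w.1.adicCompletion L)), 1; 1, 0] : Matrix (Fin 2) (Fin 2) (w.1.adicCompletion L)) = placeForm (Matrix.of fun i j : Fin 2 => if i.val + j.val + 1 = 2 then (1 : L) else 0) w.1 := by
    rw [placeForm_antidiagOne, stdForm_antidiagonal_two_over_eq]
  have hB₀' : B₀ ∈ (unitaryGroupOfForm (galAdicCompletionMap (L := L) (IsCMField.complexConj L) hw) (placeForm (Matrix.of fun i j : Fin 2 => if i.val + j.val + 1 = 2 then (1 : L) else 0) w.1)) := by rw [← hH]; exact hB₀
  set γ₂ : ((cmDatum L 2 (Matrix.of fun i j : Fin 2 => if i.val + j.val + 1 = 2 then (1 : L) else 0)).Local v) := ((localNonsplitEquiv (IsCMField.complexConj L) (Matrix.of fun i j : Fin 2 => if i.val + j.val + 1 = 2 then (1 : L) else 0) (IsCMField.complexConj_ne_one L) w hw)).symm ⟨B₀, hB₀'⟩ with hγ₂def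
  have heγ : (((localNonsplitEquiv (IsCMField.complexConj L) (Matrix.of fun i j : Fin 2 => if i.val + j.val + 1 = 2 then (1 : L) else 0) (IsCMField.complexConj_ne_one L) w hw) γ₂ : ↥(unitaryGroupOfForm (galAdicCompletionMap (L := L) (IsCMField.complexConj L) hw) (placeForm (Matrix.of fun i j : Fin 2 => if i.val + j.val + 1 = 2 then (1 : L) else 0) w.1))) : GL (Fin 2) (w.1.adicCompletion L)) = B₀ := by
    rw [hγ₂def, ContinuousMulEquiv.apply_symm_apply]
  have h := ncard_selfDual_fixed_lev_eq_of_top_of_even_depth_ramified L v w hw he h2 ϖ hϖ hσϖ γ₂ (by rw [heγ]; exact hirr) (n := n) (by rw [heγ]; exact hN) hd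
    (by rw [heγ]; exact hcD)
  rw [heγ, ← hH] at h
  exact h

set_option maxHeartbeats 1600000 in
-- budget only: statement-heavy CM-place tokens (two dresses).
include hw in
/-- **THE TOP REGION SPLITS INTO CLASS-KEYED HALVES OF `q + 1`, CLASS PRESENT (`GL` dress).**  For `B₀ ∈ U(σ_w, !![0,1;1,0])` with no root of `χ_{B₀}` in `L_w` and
`|tr² − 4det|(B₀) = exp(−2·2n)`, `n ≥ 1`, at a tame-ramified place, `d + 1 = 2n`, `|½tr B₀ − 1| ≤ |ϖ^(d+1)|`, ANY unit `c₀` and a residual non-square unit `ε`: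
`2·#{B ∣ SD_{!![0,1;1,0]} B, B₀B = B, (B₀ − 1)B ⊆ ϖ^d B ∧ CLS_d(c₀)(B)} = q + 1`, `CLS_d(c₀)(B) :⟺ ∃ y ∈ B, a ∈ 𝒪^×, |(ϖ^d)⁻¹⟨y, (B₀ − 1)y⟩ − c₀a²| < 1` (pairing for `!![0,1;1,0]`) — the right-hand
side of ★ `ncard_rootRegion_class_eq_ncard_two_of_top` at `K = L_w`; ★ part XI at `γ₂ := e₂⁻¹B₀`.
[cite: LabesseLanglands1979, §2 Lemma 2.1 p. 8] [cite: Kottwitz1986, §3] [cite: Rogawski1990, §4.9 Lemma 4.9.3 p. 56] -/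
theorem two_mul_ncard_selfDual_fixed_lev_class_eq_of_top_of_mem_unitaryGroupOfForm (he : v.asIdeal.ramificationIdx' w.1.asIdeal ≠ 1) (h2 : IsUnit (2 : 𝒪[(w.1.adicCompletion L)]))
    (ϖ : (w.1.adicCompletion L)ˣ) (hϖ : Valued.v (ϖ : (w.1.adicCompletion L)) = WithZero.exp (-1 : ℤ))
    (hσϖ : (galAdicCompletionMap (L := L) (IsCMField.complexConj L) hw) (ϖ : (w.1.adicCompletion L)) = -(ϖ : (w.1.adicCompletion L)))
    (B₀ : GL (Fin 2) (w.1.adicCompletion L)) (hB₀ : B₀ ∈ unitaryGroupOfForm (galAdicCompletionMap (L := L) (IsCMField.complexConj L) hw) (!![(0 : (w.1.adicCompletion L)), 1; 1, 0] : Matrix (Fin 2) (Fin 2) (w.1.adicCompletion L)))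
    (hirr : ¬ ∃ x : (w.1.adicCompletion L), (((B₀ : Matrix (Fin 2) (Fin 2) (w.1.adicCompletion L))).charpoly).IsRoot x)
    {n : ℕ} (hN : Valued.v (((B₀ : Matrix (Fin 2) (Fin 2) (w.1.adicCompletion L))).trace ^ 2 - 4 * ((B₀ : Matrix (Fin 2) (Fin 2) (w.1.adicCompletion L))).det) = WithZero.exp (-((2 * (2 * n) : ℕ) : ℤ))) (hn1 : 1 ≤ n) {d : ℕ} (hd : d + 1 = 2 * n)
    (hcD : Valued.v ((B₀ : Matrix (Fin 2) (Fin 2) (w.1.adicCompletion L)).trace / 2 - 1) ≤ Valued.v ((ϖ : (w.1.adicCompletion L)) ^ (d + 1)))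
    (c₀ ε : (w.1.adicCompletion L)) (hc₀ : Valued.v c₀ = 1) (hεv : Valued.v ε = 1) (hε : ∀ z : (w.1.adicCompletion L), Valued.v z ≤ 1 → Valued.v (z ^ 2 - ε) = 1) :
    2 * {B : Submodule (Valued.integer (w.1.adicCompletion L)) (Fin 2 → (w.1.adicCompletion L)) | IsSelfDualLattice (galAdicCompletionMap (L := L) (IsCMField.complexConj L) hw) (ϖ : (w.1.adicCompletion L)) (!![(0 : (w.1.adicCompletion L)), 1; 1, 0] : Matrix (Fin 2) (Fin 2) (w.1.adicCompletion L)) B ∧ mapGL B₀ B = B ∧ (B.map ((Matrix.toLin' ((B₀ : Matrix (Fin 2) (Fin 2) (w.1.adicCompletion L)) - 1)).restrictScalars (Valued.integer (w.1.adicCompletion L))) ≤ scaleLattice ((ϖ : (w.1.adicCompletion L)) ^ d) B ∧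
          ∃ y₂ ∈ B, ∃ a : (w.1.adicCompletion L), Valued.v a = 1 ∧ Valued.v (((ϖ : (w.1.adicCompletion L)) ^ d)⁻¹ * pairing (galAdicCompletionMap (L := L) (IsCMField.complexConj L) hw) (!![(0 : (w.1.adicCompletion L)), 1; 1, 0] : Matrix (Fin 2) (Fin 2) (w.1.adicCompletion L)) y₂ (((B₀ : Matrix (Fin 2) (Fin 2) (w.1.adicCompletion L)) - 1) *ᵥ y₂) - c₀ * a ^ 2) < 1)}.ncard = (Nat.card (𝓞 ↥(maximalRealSubfield L) ⧸ v.asIdeal)) + 1 := by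
  have hH : (!![(0 : (w.1.adicCompletion L)), 1; 1, 0] : Matrix (Fin 2) (Fin 2) (w.1.adicCompletion L)) = placeForm (Matrix.of fun i j : Fin 2 => if i.val + j.val + 1 = 2 then (1 : L) else 0) w.1 := by
    rw [placeForm_antidiagOne, stdForm_antidiagonal_two_over_eq]
  have hB₀' : B₀ ∈ (unitaryGroupOfForm (galAdicCompletionMap (L := L) (IsCMField.complexConj L) hw) (placeForm (Matrix.of fun i j : Fin 2 => if i.val + j.val + 1 = 2 then (1 : L) else 0) w.1)) := by rw [← hH]; exact hB₀
  set γ₂ : ((cmDatum L 2 (Matrix.of fun i j : Fin 2 => if i.val + j.val + 1 = 2 then (1 : L) else 0)).Local v) := ((localNonsplitEquiv (IsCMField.complexConj L) (Matrix.of fun i j : Fin 2 => if i.val + j.val + 1 = 2 then (1 : L) else 0) (IsCMField.complexConj_ne_one L) w hw)).symm ⟨B₀, hB₀'⟩ with hγ₂def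
  have heγ : (((localNonsplitEquiv (IsCMField.complexConj L) (Matrix.of fun i j : Fin 2 => if i.val + j.val + 1 = 2 then (1 : L) else 0) (IsCMField.complexConj_ne_one L) w hw) γ₂ : ↥(unitaryGroupOfForm (galAdicCompletionMap (L := L) (IsCMField.complexConj L) hw) (placeForm (Matrix.of fun i j : Fin 2 => if i.val + j.val + 1 = 2 then (1 : L) else 0) w.1))) : GL (Fin 2) (w.1.adicCompletion L)) = B₀ := by
    rw [hγ₂def, ContinuousMulEquiv.apply_symm_apply]
  have h := two_mul_ncard_selfDual_fixed_lev_class_eq_of_top_of_even_depth_ramified L v w hw he h2 ϖ hϖ hσϖ γ₂ (by rw [heγ]; exact hirr) (n := n)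
    (by rw [heγ]; exact hN) hn1 hd (by rw [heγ]; exact hcD) c₀ ε hc₀ hεv hε
  rw [heγ, ← hH] at h
  exact h

set_option maxHeartbeats 1600000 in
-- budget only: statement-heavy CM-place tokens (two dresses).
include hw in
/-- **THE TOP REGION SPLITS INTO CLASS-KEYED HALVES OF `q + 1`, CLASS ABSENT (`GL` dress)** — the `¬CLS_d(c₀)` twin (the right-hand side of ★
`ncard_rootRegion_not_class_eq_ncard_two_of_top` at `K = L_w`). [cite: LabesseLanglands1979, §2 Lemma 2.1 p. 8] [cite: Kottwitz1986, §3] [cite: Rogawski1990, §4.9 Lemma 4.9.3 p. 56] -/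
theorem two_mul_ncard_selfDual_fixed_lev_not_class_eq_of_top_of_mem_unitaryGroupOfForm (he : v.asIdeal.ramificationIdx' w.1.asIdeal ≠ 1) (h2 : IsUnit (2 : 𝒪[(w.1.adicCompletion L)]))
    (ϖ : (w.1.adicCompletion L)ˣ) (hϖ : Valued.v (ϖ : (w.1.adicCompletion L)) = WithZero.exp (-1 : ℤ))
    (hσϖ : (galAdicCompletionMap (L := L) (IsCMField.complexConj L) hw) (ϖ : (w.1.adicCompletion L)) = -(ϖ : (w.1.adicCompletion L)))
    (B₀ : GL (Fin 2) (w.1.adicCompletion L)) (hB₀ : B₀ ∈ unitaryGroupOfForm (galAdicCompletionMap (L := L) (IsCMField.complexConj L) hw) (!![(0 : (w.1.adicCompletion L)), 1; 1, 0] : Matrix (Fin 2) (Fin 2) (w.1.adicCompletion L)))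
    (hirr : ¬ ∃ x : (w.1.adicCompletion L), (((B₀ : Matrix (Fin 2) (Fin 2) (w.1.adicCompletion L))).charpoly).IsRoot x)
    {n : ℕ} (hN : Valued.v (((B₀ : Matrix (Fin 2) (Fin 2) (w.1.adicCompletion L))).trace ^ 2 - 4 * ((B₀ : Matrix (Fin 2) (Fin 2) (w.1.adicCompletion L))).det) = WithZero.exp (-((2 * (2 * n) : ℕ) : ℤ))) (hn1 : 1 ≤ n) {d : ℕ} (hd : d + 1 = 2 * n)
    (hcD : Valued.v ((B₀ : Matrix (Fin 2) (Fin 2) (w.1.adicCompletion L)).trace / 2 - 1) ≤ Valued.v ((ϖ : (w.1.adicCompletion L)) ^ (d + 1)))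
    (c₀ ε : (w.1.adicCompletion L)) (hc₀ : Valued.v c₀ = 1) (hεv : Valued.v ε = 1) (hε : ∀ z : (w.1.adicCompletion L), Valued.v z ≤ 1 → Valued.v (z ^ 2 - ε) = 1) :
    2 * {B : Submodule (Valued.integer (w.1.adicCompletion L)) (Fin 2 → (w.1.adicCompletion L)) | IsSelfDualLattice (galAdicCompletionMap (L := L) (IsCMField.complexConj L) hw) (ϖ : (w.1.adicCompletion L)) (!![(0 : (w.1.adicCompletion L)), 1; 1, 0] : Matrix (Fin 2) (Fin 2) (w.1.adicCompletion L)) B ∧ mapGL B₀ B = B ∧ (B.map ((Matrix.toLin' ((B₀ : Matrix (Fin 2) (Fin 2) (w.1.adicCompletion L)) - 1)).restrictScalars (Valued.integer (w.1.adicCompletion L))) ≤ scaleLattice ((ϖ : (w.1.adicCompletion L)) ^ d) B ∧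
          ¬ (∃ y₂ ∈ B, ∃ a : (w.1.adicCompletion L), Valued.v a = 1 ∧ Valued.v (((ϖ : (w.1.adicCompletion L)) ^ d)⁻¹ * pairing (galAdicCompletionMap (L := L) (IsCMField.complexConj L) hw) (!![(0 : (w.1.adicCompletion L)), 1; 1, 0] : Matrix (Fin 2) (Fin 2) (w.1.adicCompletion L)) y₂ (((B₀ : Matrix (Fin 2) (Fin 2) (w.1.adicCompletion L)) - 1) *ᵥ y₂) - c₀ * a ^ 2) < 1))}.ncard = (Nat.card (𝓞 ↥(maximalRealSubfield L) ⧸ v.asIdeal)) + 1 := by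
  have hH : (!![(0 : (w.1.adicCompletion L)), 1; 1, 0] : Matrix (Fin 2) (Fin 2) (w.1.adicCompletion L)) = placeForm (Matrix.of fun i j : Fin 2 => if i.val + j.val + 1 = 2 then (1 : L) else 0) w.1 := by
    rw [placeForm_antidiagOne, stdForm_antidiagonal_two_over_eq]
  have hB₀' : B₀ ∈ (unitaryGroupOfForm (galAdicCompletionMap (L := L) (IsCMField.complexConj L) hw) (placeForm (Matrix.of fun i j : Fin 2 => if i.val + j.val + 1 = 2 then (1 : L) else 0) w.1)) := by rw [← hH]; exact hB₀
  set γ₂ : ((cmDatum L 2 (Matrix.of fun i j : Fin 2 => if i.val + j.val + 1 = 2 then (1 : L) else 0)).Local v) := ((localNonsplitEquiv (IsCMField.complexConj L) (Matrix.of fun i j : Fin 2 => if i.val + j.val + 1 = 2 then (1 : L) else 0) (IsCMField.complexConj_ne_one L) w hw)).symm ⟨B₀, hB₀'⟩ with hγ₂def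
  have heγ : (((localNonsplitEquiv (IsCMField.complexConj L) (Matrix.of fun i j : Fin 2 => if i.val + j.val + 1 = 2 then (1 : L) else 0) (IsCMField.complexConj_ne_one L) w hw) γ₂ : ↥(unitaryGroupOfForm (galAdicCompletionMap (L := L) (IsCMField.complexConj L) hw) (placeForm (Matrix.of fun i j : Fin 2 => if i.val + j.val + 1 = 2 then (1 : L) else 0) w.1))) : GL (Fin 2) (w.1.adicCompletion L)) = B₀ := by
    rw [hγ₂def, ContinuousMulEquiv.apply_symm_apply]
  have h := two_mul_ncard_selfDual_fixed_lev_not_class_eq_of_top_of_even_depth_ramified L v w hw he h2 ϖ hϖ hσϖ γ₂ (by rw [heγ]; exact hirr) (n := n)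
    (by rw [heγ]; exact hN) hn1 hd (by rw [heγ]; exact hcD) c₀ ε hc₀ hεv hε
  rw [heγ, ← hH] at h
  exact h

/-! ## §2 The composites in JUNCTION currency at the CM place: `#R = q + 1` and the two kind counts `2·# = q + 1` (no `W`-side residue for the pens) -/

set_option maxHeartbeats 3200000 in
-- budget only: statement-heavy tokens in two currencies.
include hw in
/-- **THE A-EVEN ROOT REGION HAS `q + 1` VERTICES (junction currency, CM place).**  For `γ ∈ U(σ_w, Φ₃)` with matrix `ι(B₀, u)`, `B₀ ∈ U(σ_w, !![0,1;1,0])` with no root of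
`χ_{B₀}` in `L_w` and `|tr² − 4det|(B₀) = exp(−2·2n)`, `n ≥ 1`, root level `d₀` with `d₀ + 1 = 2n`, `|u₀₀| = 1`, `|u₀₀ − 1| ≤ |ϖ^(d₀+1)|`, `|½tr B₀ − u₀₀| ≤ |ϖ^(d₀+1)|`:
`#{v ∣ γ·v = v ∧ SD v.1 ∧ (γ − 1)·v.1 ≤ ϖ^d₀·v.1} = q + 1` — F0P3a-p01 (g18) ★ `ncard_rootRegion_eq_ncard_two_of_top` (its `htop` DISCHARGED by ★ part X: the centred
`ϖ^(2n)`-ball is empty) ∘ §1.  The `sR.card` of the A-even cells. [cite: Kottwitz1986, §3] [cite: LabesseLanglands1979, §2 Lemma 2.1 p. 8] [cite: Rogawski1990, §4.9 Lemma 4.9.3 p. 56] -/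
theorem ncard_rootRegion_eq_of_top_of_even_depth_ramified (he : v.asIdeal.ramificationIdx' w.1.asIdeal ≠ 1) (h2 : IsUnit (2 : 𝒪[(w.1.adicCompletion L)]))
    (ϖ : (w.1.adicCompletion L)ˣ) (hϖ : Valued.v (ϖ : (w.1.adicCompletion L)) = WithZero.exp (-1 : ℤ))
    (hσϖ : (galAdicCompletionMap (L := L) (IsCMField.complexConj L) hw) (ϖ : (w.1.adicCompletion L)) = -(ϖ : (w.1.adicCompletion L)))
    (γ : unitaryGroupOfForm (galAdicCompletionMap (L := L) (IsCMField.complexConj L) hw) ((StdForm.antidiagonal 3).over (w.1.adicCompletion L))) (B₀ : GL (Fin 2) (w.1.adicCompletion L)) (u : GL (Fin 1) (w.1.adicCompletion L))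
    (hγ : (γ : GL (Fin 3) (w.1.adicCompletion L)) = endoGL (B₀, u)) (hB₀ : B₀ ∈ unitaryGroupOfForm (galAdicCompletionMap (L := L) (IsCMField.complexConj L) hw) (!![(0 : (w.1.adicCompletion L)), 1; 1, 0] : Matrix (Fin 2) (Fin 2) (w.1.adicCompletion L)))
    (hu : Valued.v ((u : Matrix (Fin 1) (Fin 1) (w.1.adicCompletion L)) 0 0) = 1)
    (hirr : ¬ ∃ x : (w.1.adicCompletion L), (((B₀ : Matrix (Fin 2) (Fin 2) (w.1.adicCompletion L))).charpoly).IsRoot x)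
    {n : ℕ} (hN : Valued.v (((B₀ : Matrix (Fin 2) (Fin 2) (w.1.adicCompletion L))).trace ^ 2 - 4 * ((B₀ : Matrix (Fin 2) (Fin 2) (w.1.adicCompletion L))).det) = WithZero.exp (-((2 * (2 * n) : ℕ) : ℤ))) (hn1 : 1 ≤ n)
    {d₀ : ℕ} (hd : d₀ + 1 = 2 * n) (hud : Valued.v ((u : Matrix (Fin 1) (Fin 1) (w.1.adicCompletion L)) 0 0 - 1) ≤ Valued.v ((ϖ : (w.1.adicCompletion L)) ^ (d₀ + 1)))
    (hα : Valued.v ((B₀ : Matrix (Fin 2) (Fin 2) (w.1.adicCompletion L)).trace / 2 - (u : Matrix (Fin 1) (Fin 1) (w.1.adicCompletion L)) 0 0) ≤ Valued.v ((ϖ : (w.1.adicCompletion L)) ^ (d₀ + 1))) :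
    {v : {M : Submodule (Valued.integer (w.1.adicCompletion L)) (Fin 3 → (w.1.adicCompletion L)) // IsVertex (galAdicCompletionMap (L := L) (IsCMField.complexConj L) hw) (ϖ : (w.1.adicCompletion L)) ((StdForm.antidiagonal 3).over (w.1.adicCompletion L)) M} | latticeGraphIso (galAdicCompletionMap (L := L) (IsCMField.complexConj L) hw) (ϖ : (w.1.adicCompletion L)) ((StdForm.antidiagonal 3).over (w.1.adicCompletion L)) γ v = v ∧ IsSelfDualLattice (galAdicCompletionMap (L := L) (IsCMField.complexConj L) hw) (ϖ : (w.1.adicCompletion L)) ((StdForm.antidiagonal 3).over (w.1.adicCompletion L)) v.1 ∧ v.1.map ((Matrix.toLin' (((γ : GL (Fin 3) (w.1.adicCompletion L)) : Matrix (Fin 3) (Fin 3) (w.1.adicCompletion L)) - 1)).restrictScalars (Valued.integer (w.1.adicCompletion L))) ≤ scaleLattice ((ϖ : (w.1.adicCompletion L)) ^ d₀) v.1}.ncard = (Nat.card (𝓞 ↥(maximalRealSubfield L) ⧸ v.asIdeal)) + 1 := by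
  have hc1 : IsCMField.complexConj L ≠ 1 := IsCMField.complexConj_ne_one L
  have hσ : ∀ a, (galAdicCompletionMap (L := L) (IsCMField.complexConj L) hw) ((galAdicCompletionMap (L := L) (IsCMField.complexConj L) hw) a) = a := fun a =>
    Liu2021.galAdicCompletionMap_galAdicCompletionMap_self (↥(maximalRealSubfield L)) L (IsCMField.complexConj L)
      (AlgEquiv.ext fun x => IsCMField.complexConj_apply_apply L x) hw a
  have hvσ : ∀ a, Valued.v ((galAdicCompletionMap (L := L) (IsCMField.complexConj L) hw) a) = Valued.v a := fun a => valued_galAdicCompletionMap (L := L) (IsCMField.complexConj L) hw a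
  have h2w : Valued.v (2 : (w.1.adicCompletion L)) = 1 := by
    have h := ((Valuation.integer.integers (ValuativeRel.valuation (w.1.adicCompletion L))).isUnit_iff_valuation_eq_one).1 h2
    exact (v_eq_one_iff_valuation_eq_one _).2 h
  have hϖ0 : (ϖ : (w.1.adicCompletion L)) ≠ 0 := ϖ.ne_zero
  have hϖ1 : Valued.v (ϖ : (w.1.adicCompletion L)) ≤ 1 := by rw [hϖ, ← WithZero.exp_zero]; exact WithZero.exp_le_exp.2 (by norm_num)
  haveI := isPrincipalIdealRing_integer_adicCompletion L v w
  have hH : (!![(0 : (w.1.adicCompletion L)), 1; 1, 0] : Matrix (Fin 2) (Fin 2) (w.1.adicCompletion L)) = placeForm (Matrix.of fun i j : Fin 2 => if i.val + j.val + 1 = 2 then (1 : L) else 0) w.1 := by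
    rw [placeForm_antidiagOne, stdForm_antidiagonal_two_over_eq]
  have hB₀' : B₀ ∈ (unitaryGroupOfForm (galAdicCompletionMap (L := L) (IsCMField.complexConj L) hw) (placeForm (Matrix.of fun i j : Fin 2 => if i.val + j.val + 1 = 2 then (1 : L) else 0) w.1)) := by rw [← hH]; exact hB₀
  set γ₂ : ((cmDatum L 2 (Matrix.of fun i j : Fin 2 => if i.val + j.val + 1 = 2 then (1 : L) else 0)).Local v) := ((localNonsplitEquiv (IsCMField.complexConj L) (Matrix.of fun i j : Fin 2 => if i.val + j.val + 1 = 2 then (1 : L) else 0) (IsCMField.complexConj_ne_one L) w hw)).symm ⟨B₀, hB₀'⟩ with hγ₂def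
  have heγ : (((localNonsplitEquiv (IsCMField.complexConj L) (Matrix.of fun i j : Fin 2 => if i.val + j.val + 1 = 2 then (1 : L) else 0) (IsCMField.complexConj_ne_one L) w hw) γ₂ : ↥(unitaryGroupOfForm (galAdicCompletionMap (L := L) (IsCMField.complexConj L) hw) (placeForm (Matrix.of fun i j : Fin 2 => if i.val + j.val + 1 = 2 then (1 : L) else 0) w.1))) : GL (Fin 2) (w.1.adicCompletion L)) = B₀ := by
    rw [hγ₂def, ContinuousMulEquiv.apply_symm_apply]
  have hpow : ∀ {m k : ℕ}, k ≤ m → Valued.v ((ϖ : (w.1.adicCompletion L)) ^ m) ≤ Valued.v ((ϖ : (w.1.adicCompletion L)) ^ k) := fun {m k} h => by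
    rw [map_pow, map_pow]; exact pow_le_pow_right_of_le_one' hϖ1 h
  -- `|½tr B₀ − 1| ≤ |ϖ^(d₀+1)|` from `hα`, `hud`
  have hcD : Valued.v ((B₀ : Matrix (Fin 2) (Fin 2) (w.1.adicCompletion L)).trace / 2 - 1) ≤ Valued.v ((ϖ : (w.1.adicCompletion L)) ^ (d₀ + 1)) := by
    rw [show (B₀ : Matrix (Fin 2) (Fin 2) (w.1.adicCompletion L)).trace / 2 - 1 = ((B₀ : Matrix (Fin 2) (Fin 2) (w.1.adicCompletion L)).trace / 2 - (u : Matrix (Fin 1) (Fin 1) (w.1.adicCompletion L)) 0 0) + ((u : Matrix (Fin 1) (Fin 1) (w.1.adicCompletion L)) 0 0 - 1) by ring]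
    exact (Valuation.map_add _ _ _).trans (max_le hα hud)
  -- TOP-ness: the centred `ϖ^(d₀+1) = ϖ^(2n)`-ball of `B₀`-fixed self-dual lattices is EMPTY (★ part X §1 at `γ₂ := e₂⁻¹B₀`)
  have htop : {B : Submodule (Valued.integer (w.1.adicCompletion L)) (Fin 2 → (w.1.adicCompletion L)) | IsSelfDualLattice (galAdicCompletionMap (L := L) (IsCMField.complexConj L) hw) (ϖ : (w.1.adicCompletion L)) (!![(0 : (w.1.adicCompletion L)), 1; 1, 0] : Matrix (Fin 2) (Fin 2) (w.1.adicCompletion L)) B ∧ mapGL B₀ B = B ∧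
        B.map ((Matrix.toLin' ((B₀ : Matrix (Fin 2) (Fin 2) (w.1.adicCompletion L)) - ((B₀ : Matrix (Fin 2) (Fin 2) (w.1.adicCompletion L)).trace / 2) • (1 : Matrix (Fin 2) (Fin 2) (w.1.adicCompletion L)))).restrictScalars (Valued.integer (w.1.adicCompletion L))) ≤
          scaleLattice ((ϖ : (w.1.adicCompletion L)) ^ (d₀ + 1)) B} = ∅ := by
    have hFfin := finite_selfDual_fixed_of_even_depth_ramified L v w hw he h2 ϖ hϖ hσϖ γ₂ (by rw [heγ]; exact hirr) (n := n) (by rw [heγ]; exact hN) hn1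
    have h0 := ncard_selfDual_fixed_centredBall_top_eq_zero_of_even_depth_ramified L v w hw he h2 ϖ hϖ hσϖ γ₂ (by rw [heγ]; exact hirr) (n := n)
      (by rw [heγ]; exact hN) hn1
    have hempty := (Set.ncard_eq_zero (hFfin.subset fun B hB => ⟨hB.1, hB.2.1⟩)).1 h0
    rw [heγ, ← hH, ← hd] at hempty
    exact hempty
  rw [ncard_rootRegion_eq_ncard_two_of_top hσ hvσ hϖ h2w γ B₀ u hγ hB₀ hu (hud.trans (hpow (Nat.le_succ d₀))) hα htop]
  exact ncard_selfDual_fixed_lev_eq_of_top_of_mem_unitaryGroupOfForm L v w hw he h2 ϖ hϖ hσϖ B₀ hB₀ hirr hN hd (hcD.trans (hpow (Nat.le_succ d₀)))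

set_option maxHeartbeats 3200000 in
-- budget only: statement-heavy tokens in two currencies.
include hw in
/-- **THE A-EVEN KIND COUNT, CLASS PRESENT (junction currency, CM place):** under the hypotheses of `ncard_rootRegion_eq_of_top_of_even_depth_ramified`, for ANY unit `c₀` and a
residual non-square unit `ε`: `2·#{v ∣ v ∈ R ∧ CLS_(d₀)(c₀)(v.1)} = q + 1` (`CLS_(d₀)(c₀)(v.1) :⟺ ∃ y ∈ v.1, a ∈ 𝒪^×, |(ϖ^d₀)⁻¹⟨y, (γ − 1)y⟩_{Φ₃} − c₀a²| < 1`, the raw head's class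
token at scale `d₀`) — ★ `ncard_rootRegion_class_eq_ncard_two_of_top` ∘ §1.  With `Q v := CLS_(d₀)(−c₁)(v.1)` these are the kind multiplicities `n₁ = n₂ = (q+1)∕2` of ★
`regionCensus_block_of_kindCounts` (F0P3-p03 (g16)) for `stub_Zhyp_{zero,pm}_even_A`. [cite: Kottwitz1986, §3] [cite: LabesseLanglands1979, §2 Lemma 2.1 p. 8] [cite: Rogawski1990, §4.9 Lemma 4.9.3 p. 56] -/
theorem two_mul_ncard_rootRegion_class_eq_of_top_of_even_depth_ramified (he : v.asIdeal.ramificationIdx' w.1.asIdeal ≠ 1) (h2 : IsUnit (2 : 𝒪[(w.1.adicCompletion L)]))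
    (ϖ : (w.1.adicCompletion L)ˣ) (hϖ : Valued.v (ϖ : (w.1.adicCompletion L)) = WithZero.exp (-1 : ℤ))
    (hσϖ : (galAdicCompletionMap (L := L) (IsCMField.complexConj L) hw) (ϖ : (w.1.adicCompletion L)) = -(ϖ : (w.1.adicCompletion L)))
    (γ : unitaryGroupOfForm (galAdicCompletionMap (L := L) (IsCMField.complexConj L) hw) ((StdForm.antidiagonal 3).over (w.1.adicCompletion L))) (B₀ : GL (Fin 2) (w.1.adicCompletion L)) (u : GL (Fin 1) (w.1.adicCompletion L))
    (hγ : (γ : GL (Fin 3) (w.1.adicCompletion L)) = endoGL (B₀, u)) (hB₀ : B₀ ∈ unitaryGroupOfForm (galAdicCompletionMap (L := L) (IsCMField.complexConj L) hw) (!![(0 : (w.1.adicCompletion L)), 1; 1, 0] : Matrix (Fin 2) (Fin 2) (w.1.adicCompletion L)))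
    (hu : Valued.v ((u : Matrix (Fin 1) (Fin 1) (w.1.adicCompletion L)) 0 0) = 1)
    (hirr : ¬ ∃ x : (w.1.adicCompletion L), (((B₀ : Matrix (Fin 2) (Fin 2) (w.1.adicCompletion L))).charpoly).IsRoot x)
    {n : ℕ} (hN : Valued.v (((B₀ : Matrix (Fin 2) (Fin 2) (w.1.adicCompletion L))).trace ^ 2 - 4 * ((B₀ : Matrix (Fin 2) (Fin 2) (w.1.adicCompletion L))).det) = WithZero.exp (-((2 * (2 * n) : ℕ) : ℤ))) (hn1 : 1 ≤ n)
    {d₀ : ℕ} (hd : d₀ + 1 = 2 * n) (hud : Valued.v ((u : Matrix (Fin 1) (Fin 1) (w.1.adicCompletion L)) 0 0 - 1) ≤ Valued.v ((ϖ : (w.1.adicCompletion L)) ^ (d₀ + 1)))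
    (hα : Valued.v ((B₀ : Matrix (Fin 2) (Fin 2) (w.1.adicCompletion L)).trace / 2 - (u : Matrix (Fin 1) (Fin 1) (w.1.adicCompletion L)) 0 0) ≤ Valued.v ((ϖ : (w.1.adicCompletion L)) ^ (d₀ + 1)))
    (c₀ ε : (w.1.adicCompletion L)) (hc₀ : Valued.v c₀ = 1) (hεv : Valued.v ε = 1) (hε : ∀ z : (w.1.adicCompletion L), Valued.v z ≤ 1 → Valued.v (z ^ 2 - ε) = 1) :
    2 * {v : {M : Submodule (Valued.integer (w.1.adicCompletion L)) (Fin 3 → (w.1.adicCompletion L)) // IsVertex (galAdicCompletionMap (L := L) (IsCMField.complexConj L) hw) (ϖ : (w.1.adicCompletion L)) ((StdForm.antidiagonal 3).over (w.1.adicCompletion L)) M} | v ∈ {v : {M : Submodule (Valued.integer (w.1.adicCompletion L)) (Fin 3 → (w.1.adicCompletion L)) // IsVertex (galAdicCompletionMap (L := L) (IsCMField.complexConj L) hw) (ϖ : (w.1.adicCompletion L)) ((StdForm.antidiagonal 3).over (w.1.adicCompletion L)) M} | latticeGraphIso (galAdicCompletionMap (L := L) (IsCMField.complexConj L) hw) (ϖ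 : (w.1.adicCompletion L)) ((StdForm.antidiagonal 3).over (w.1.adicCompletion L)) γ v = v ∧ IsSelfDualLattice (galAdicCompletionMap (L := L) (IsCMField.complexConj L) hw) (ϖ : (w.1.adicCompletion L)) ((StdForm.antidiagonal 3).over (w.1.adicCompletion L)) v.1 ∧ v.1.map ((Matrix.toLin' (((γ : GL (Fin 3) (w.1.adicCompletion L)) : Matrix (Fin 3) (Fin 3) (w.1.adicCompletion L)) - 1)).restrictScalars (Valued.integer (w.1.adicCompletion L))) ≤ scaleLattice ((ϖ : (w.1.adicCompletion L)) ^ d₀) v.1} ∧ ∃ y ∈ v.1, ∃ a : (w.1.adicCompletion L), Valued.v a = 1 ∧ Valued.v (((ϖ : (w.1.adicCompletion L)) ^ d₀)⁻¹ * pairing (galAdicCompletionMap (L := L) (IsCMField.complexConj L) hw) ((StdForm.antidiagonal 3).over (w.1.adicCompletion L)) y ((((γ : GL (Fin 3) (w.1.adicCompletion L)) : Matrix (Fin 3) (Fin 3) (w.1.adicCompletion L)) - 1) *ᵥ y) - c₀ * a ^ 2) < 1}.ncard = (Nat.card (𝓞 ↥(maximalRealSubfield L) ⧸ v.asIdeal))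 + 1 := by
  have hc1 : IsCMField.complexConj L ≠ 1 := IsCMField.complexConj_ne_one L
  have hσ : ∀ a, (galAdicCompletionMap (L := L) (IsCMField.complexConj L) hw) ((galAdicCompletionMap (L := L) (IsCMField.complexConj L) hw) a) = a := fun a =>
    Liu2021.galAdicCompletionMap_galAdicCompletionMap_self (↥(maximalRealSubfield L)) L (IsCMField.complexConj L)
      (AlgEquiv.ext fun x => IsCMField.complexConj_apply_apply L x) hw a
  have hvσ : ∀ a, Valued.v ((galAdicCompletionMap (L := L) (IsCMField.complexConj L) hw) a) = Valued.v a := fun a => valued_galAdicCompletionMap (L := L) (IsCMField.complexConj L) hw a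
  have h2w : Valued.v (2 : (w.1.adicCompletion L)) = 1 := by
    have h := ((Valuation.integer.integers (ValuativeRel.valuation (w.1.adicCompletion L))).isUnit_iff_valuation_eq_one).1 h2
    exact (v_eq_one_iff_valuation_eq_one _).2 h
  have hϖ0 : (ϖ : (w.1.adicCompletion L)) ≠ 0 := ϖ.ne_zero
  have hϖ1 : Valued.v (ϖ : (w.1.adicCompletion L)) ≤ 1 := by rw [hϖ, ← WithZero.exp_zero]; exact WithZero.exp_le_exp.2 (by norm_num)
  haveI := isPrincipalIdealRing_integer_adicCompletion L v w
  have hH : (!![(0 : (w.1.adicCompletion L)), 1; 1, 0] : Matrix (Fin 2) (Fin 2) (w.1.adicCompletion L)) = placeForm (Matrix.of fun i j : Fin 2 => if i.val + j.val + 1 = 2 then (1 : L) else 0) w.1 := by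
    rw [placeForm_antidiagOne, stdForm_antidiagonal_two_over_eq]
  have hB₀' : B₀ ∈ (unitaryGroupOfForm (galAdicCompletionMap (L := L) (IsCMField.complexConj L) hw) (placeForm (Matrix.of fun i j : Fin 2 => if i.val + j.val + 1 = 2 then (1 : L) else 0) w.1)) := by rw [← hH]; exact hB₀
  set γ₂ : ((cmDatum L 2 (Matrix.of fun i j : Fin 2 => if i.val + j.val + 1 = 2 then (1 : L) else 0)).Local v) := ((localNonsplitEquiv (IsCMField.complexConj L) (Matrix.of fun i j : Fin 2 => if i.val + j.val + 1 = 2 then (1 : L) else 0) (IsCMField.complexConj_ne_one L) w hw)).symm ⟨B₀, hB₀'⟩ with hγ₂def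
  have heγ : (((localNonsplitEquiv (IsCMField.complexConj L) (Matrix.of fun i j : Fin 2 => if i.val + j.val + 1 = 2 then (1 : L) else 0) (IsCMField.complexConj_ne_one L) w hw) γ₂ : ↥(unitaryGroupOfForm (galAdicCompletionMap (L := L) (IsCMField.complexConj L) hw) (placeForm (Matrix.of fun i j : Fin 2 => if i.val + j.val + 1 = 2 then (1 : L) else 0) w.1))) : GL (Fin 2) (w.1.adicCompletion L)) = B₀ := by
    rw [hγ₂def, ContinuousMulEquiv.apply_symm_apply]
  have hpow : ∀ {m k : ℕ}, k ≤ m → Valued.v ((ϖ : (w.1.adicCompletion L)) ^ m) ≤ Valued.v ((ϖ : (w.1.adicCompletion L)) ^ k) := fun {m k} h => by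
    rw [map_pow, map_pow]; exact pow_le_pow_right_of_le_one' hϖ1 h
  -- `|½tr B₀ − 1| ≤ |ϖ^(d₀+1)|` from `hα`, `hud`
  have hcD : Valued.v ((B₀ : Matrix (Fin 2) (Fin 2) (w.1.adicCompletion L)).trace / 2 - 1) ≤ Valued.v ((ϖ : (w.1.adicCompletion L)) ^ (d₀ + 1)) := by
    rw [show (B₀ : Matrix (Fin 2) (Fin 2) (w.1.adicCompletion L)).trace / 2 - 1 = ((B₀ : Matrix (Fin 2) (Fin 2) (w.1.adicCompletion L)).trace / 2 - (u : Matrix (Fin 1) (Fin 1) (w.1.adicCompletion L)) 0 0) + ((u : Matrix (Fin 1) (Fin 1) (w.1.adicCompletion L)) 0 0 - 1) by ring]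
    exact (Valuation.map_add _ _ _).trans (max_le hα hud)
  -- TOP-ness: the centred `ϖ^(d₀+1) = ϖ^(2n)`-ball of `B₀`-fixed self-dual lattices is EMPTY (★ part X §1 at `γ₂ := e₂⁻¹B₀`)
  have htop : {B : Submodule (Valued.integer (w.1.adicCompletion L)) (Fin 2 → (w.1.adicCompletion L)) | IsSelfDualLattice (galAdicCompletionMap (L := L) (IsCMField.complexConj L) hw) (ϖ : (w.1.adicCompletion L)) (!![(0 : (w.1.adicCompletion L)), 1; 1, 0] : Matrix (Fin 2) (Fin 2) (w.1.adicCompletion L)) B ∧ mapGL B₀ B = B ∧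
        B.map ((Matrix.toLin' ((B₀ : Matrix (Fin 2) (Fin 2) (w.1.adicCompletion L)) - ((B₀ : Matrix (Fin 2) (Fin 2) (w.1.adicCompletion L)).trace / 2) • (1 : Matrix (Fin 2) (Fin 2) (w.1.adicCompletion L)))).restrictScalars (Valued.integer (w.1.adicCompletion L))) ≤
          scaleLattice ((ϖ : (w.1.adicCompletion L)) ^ (d₀ + 1)) B} = ∅ := by
    have hFfin := finite_selfDual_fixed_of_even_depth_ramified L v w hw he h2 ϖ hϖ hσϖ γ₂ (by rw [heγ]; exact hirr) (n := n) (by rw [heγ]; exact hN) hn1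
    have h0 := ncard_selfDual_fixed_centredBall_top_eq_zero_of_even_depth_ramified L v w hw he h2 ϖ hϖ hσϖ γ₂ (by rw [heγ]; exact hirr) (n := n)
      (by rw [heγ]; exact hN) hn1
    have hempty := (Set.ncard_eq_zero (hFfin.subset fun B hB => ⟨hB.1, hB.2.1⟩)).1 h0
    rw [heγ, ← hH, ← hd] at hempty
    exact hempty
  rw [ncard_rootRegion_class_eq_ncard_two_of_top hσ hvσ hϖ h2w γ B₀ u hγ hB₀ hu hud hα htop c₀]
  exact two_mul_ncard_selfDual_fixed_lev_class_eq_of_top_of_mem_unitaryGroupOfForm L v w hw he h2 ϖ hϖ hσϖ B₀ hB₀ hirr hN hn1 hd hcD c₀ ε hc₀ hεv hε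

set_option maxHeartbeats 3200000 in
-- budget only: statement-heavy tokens in two currencies.
include hw in
/-- **THE A-EVEN KIND COUNT, CLASS ABSENT (junction currency, CM place):** `2·#{v ∣ v ∈ R ∧ ¬CLS_(d₀)(c₀)(v.1)} = q + 1` (★ `ncard_rootRegion_not_class_eq_ncard_two_of_top` ∘ §1).
[cite: Kottwitz1986, §3] [cite: LabesseLanglands1979, §2 Lemma 2.1 p. 8] [cite: Rogawski1990, §4.9 Lemma 4.9.3 p. 56] -/
theorem two_mul_ncard_rootRegion_not_class_eq_of_top_of_even_depth_ramified (he : v.asIdeal.ramificationIdx' w.1.asIdeal ≠ 1) (h2 : IsUnit (2 : 𝒪[(w.1.adicCompletion L)]))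
    (ϖ : (w.1.adicCompletion L)ˣ) (hϖ : Valued.v (ϖ : (w.1.adicCompletion L)) = WithZero.exp (-1 : ℤ))
    (hσϖ : (galAdicCompletionMap (L := L) (IsCMField.complexConj L) hw) (ϖ : (w.1.adicCompletion L)) = -(ϖ : (w.1.adicCompletion L)))
    (γ : unitaryGroupOfForm (galAdicCompletionMap (L := L) (IsCMField.complexConj L) hw) ((StdForm.antidiagonal 3).over (w.1.adicCompletion L))) (B₀ : GL (Fin 2) (w.1.adicCompletion L)) (u : GL (Fin 1) (w.1.adicCompletion L))
    (hγ : (γ : GL (Fin 3) (w.1.adicCompletion L)) = endoGL (B₀, u)) (hB₀ : B₀ ∈ unitaryGroupOfForm (galAdicCompletionMap (L := L) (IsCMField.complexConj L) hw) (!![(0 : (w.1.adicCompletion L)), 1; 1, 0] : Matrix (Fin 2) (Fin 2) (w.1.adicCompletion L)))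
    (hu : Valued.v ((u : Matrix (Fin 1) (Fin 1) (w.1.adicCompletion L)) 0 0) = 1)
    (hirr : ¬ ∃ x : (w.1.adicCompletion L), (((B₀ : Matrix (Fin 2) (Fin 2) (w.1.adicCompletion L))).charpoly).IsRoot x)
    {n : ℕ} (hN : Valued.v (((B₀ : Matrix (Fin 2) (Fin 2) (w.1.adicCompletion L))).trace ^ 2 - 4 * ((B₀ : Matrix (Fin 2) (Fin 2) (w.1.adicCompletion L))).det) = WithZero.exp (-((2 * (2 * n) : ℕ) : ℤ))) (hn1 : 1 ≤ n)
    {d₀ : ℕ} (hd : d₀ + 1 = 2 * n) (hud : Valued.v ((u : Matrix (Fin 1) (Fin 1) (w.1.adicCompletion L)) 0 0 - 1) ≤ Valued.v ((ϖ : (w.1.adicCompletion L)) ^ (d₀ + 1)))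
    (hα : Valued.v ((B₀ : Matrix (Fin 2) (Fin 2) (w.1.adicCompletion L)).trace / 2 - (u : Matrix (Fin 1) (Fin 1) (w.1.adicCompletion L)) 0 0) ≤ Valued.v ((ϖ : (w.1.adicCompletion L)) ^ (d₀ + 1)))
    (c₀ ε : (w.1.adicCompletion L)) (hc₀ : Valued.v c₀ = 1) (hεv : Valued.v ε = 1) (hε : ∀ z : (w.1.adicCompletion L), Valued.v z ≤ 1 → Valued.v (z ^ 2 - ε) = 1) :
    2 * {v : {M : Submodule (Valued.integer (w.1.adicCompletion L)) (Fin 3 → (w.1.adicCompletion L)) // IsVertex (galAdicCompletionMap (L := L) (IsCMField.complexConj L) hw) (ϖ : (w.1.adicCompletion L)) ((StdForm.antidiagonal 3).over (w.1.adicCompletion L)) M} | v ∈ {v : {M : Submodule (Valued.integer (w.1.adicCompletion L)) (Fin 3 → (w.1.adicCompletion L)) // IsVertex (galAdicCompletionMap (L := L) (IsCMField.complexConj L) hw) (ϖ : (w.1.adicCompletion L)) ((StdForm.antidiagonal 3).over (w.1.adicCompletion L)) M} | latticeGraphIso (galAdicCompletionMap (L := L) (IsCMField.complexConj L) hw) (ϖ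 : (w.1.adicCompletion L)) ((StdForm.antidiagonal 3).over (w.1.adicCompletion L)) γ v = v ∧ IsSelfDualLattice (galAdicCompletionMap (L := L) (IsCMField.complexConj L) hw) (ϖ : (w.1.adicCompletion L)) ((StdForm.antidiagonal 3).over (w.1.adicCompletion L)) v.1 ∧ v.1.map ((Matrix.toLin' (((γ : GL (Fin 3) (w.1.adicCompletion L)) : Matrix (Fin 3) (Fin 3) (w.1.adicCompletion L)) - 1)).restrictScalars (Valued.integer (w.1.adicCompletion L))) ≤ scaleLattice ((ϖ : (w.1.adicCompletion L)) ^ d₀) v.1} ∧ ¬ (∃ y ∈ v.1, ∃ a : (w.1.adicCompletion L), Valued.v a = 1 ∧ Valued.v (((ϖ : (w.1.adicCompletion L)) ^ d₀)⁻¹ * pairing (galAdicCompletionMap (L := L) (IsCMField.complexConj L) hw) ((StdForm.antidiagonal 3).over (w.1.adicCompletion L)) y ((((γ : GL (Fin 3) (w.1.adicCompletion L)) : Matrix (Fin 3) (Fin 3) (w.1.adicCompletion L)) - 1) *ᵥ y) - c₀ * a ^ 2) < 1)}.ncard = (Nat.card (𝓞 ↥(maximalRealSubfield L) ⧸ v.asIdeal))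 + 1 := by
  have hc1 : IsCMField.complexConj L ≠ 1 := IsCMField.complexConj_ne_one L
  have hσ : ∀ a, (galAdicCompletionMap (L := L) (IsCMField.complexConj L) hw) ((galAdicCompletionMap (L := L) (IsCMField.complexConj L) hw) a) = a := fun a =>
    Liu2021.galAdicCompletionMap_galAdicCompletionMap_self (↥(maximalRealSubfield L)) L (IsCMField.complexConj L)
      (AlgEquiv.ext fun x => IsCMField.complexConj_apply_apply L x) hw a
  have hvσ : ∀ a, Valued.v ((galAdicCompletionMap (L := L) (IsCMField.complexConj L) hw) a) = Valued.v a := fun a => valued_galAdicCompletionMap (L := L) (IsCMField.complexConj L) hw a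
  have h2w : Valued.v (2 : (w.1.adicCompletion L)) = 1 := by
    have h := ((Valuation.integer.integers (ValuativeRel.valuation (w.1.adicCompletion L))).isUnit_iff_valuation_eq_one).1 h2
    exact (v_eq_one_iff_valuation_eq_one _).2 h
  have hϖ0 : (ϖ : (w.1.adicCompletion L)) ≠ 0 := ϖ.ne_zero
  have hϖ1 : Valued.v (ϖ : (w.1.adicCompletion L)) ≤ 1 := by rw [hϖ, ← WithZero.exp_zero]; exact WithZero.exp_le_exp.2 (by norm_num)
  haveI := isPrincipalIdealRing_integer_adicCompletion L v w
  have hH : (!![(0 : (w.1.adicCompletion L)), 1; 1, 0] : Matrix (Fin 2) (Fin 2) (w.1.adicCompletion L)) = placeForm (Matrix.of fun i j : Fin 2 => if i.val + j.val + 1 = 2 then (1 : L) else 0) w.1 := by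
    rw [placeForm_antidiagOne, stdForm_antidiagonal_two_over_eq]
  have hB₀' : B₀ ∈ (unitaryGroupOfForm (galAdicCompletionMap (L := L) (IsCMField.complexConj L) hw) (placeForm (Matrix.of fun i j : Fin 2 => if i.val + j.val + 1 = 2 then (1 : L) else 0) w.1)) := by rw [← hH]; exact hB₀
  set γ₂ : ((cmDatum L 2 (Matrix.of fun i j : Fin 2 => if i.val + j.val + 1 = 2 then (1 : L) else 0)).Local v) := ((localNonsplitEquiv (IsCMField.complexConj L) (Matrix.of fun i j : Fin 2 => if i.val + j.val + 1 = 2 then (1 : L) else 0) (IsCMField.complexConj_ne_one L) w hw)).symm ⟨B₀, hB₀'⟩ with hγ₂def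
  have heγ : (((localNonsplitEquiv (IsCMField.complexConj L) (Matrix.of fun i j : Fin 2 => if i.val + j.val + 1 = 2 then (1 : L) else 0) (IsCMField.complexConj_ne_one L) w hw) γ₂ : ↥(unitaryGroupOfForm (galAdicCompletionMap (L := L) (IsCMField.complexConj L) hw) (placeForm (Matrix.of fun i j : Fin 2 => if i.val + j.val + 1 = 2 then (1 : L) else 0) w.1))) : GL (Fin 2) (w.1.adicCompletion L)) = B₀ := by
    rw [hγ₂def, ContinuousMulEquiv.apply_symm_apply]
  have hpow : ∀ {m k : ℕ}, k ≤ m → Valued.v ((ϖ : (w.1.adicCompletion L)) ^ m) ≤ Valued.v ((ϖ : (w.1.adicCompletion L)) ^ k) := fun {m k} h => by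
    rw [map_pow, map_pow]; exact pow_le_pow_right_of_le_one' hϖ1 h
  -- `|½tr B₀ − 1| ≤ |ϖ^(d₀+1)|` from `hα`, `hud`
  have hcD : Valued.v ((B₀ : Matrix (Fin 2) (Fin 2) (w.1.adicCompletion L)).trace / 2 - 1) ≤ Valued.v ((ϖ : (w.1.adicCompletion L)) ^ (d₀ + 1)) := by
    rw [show (B₀ : Matrix (Fin 2) (Fin 2) (w.1.adicCompletion L)).trace / 2 - 1 = ((B₀ : Matrix (Fin 2) (Fin 2) (w.1.adicCompletion L)).trace / 2 - (u : Matrix (Fin 1) (Fin 1) (w.1.adicCompletion L)) 0 0) + ((u : Matrix (Fin 1) (Fin 1) (w.1.adicCompletion L)) 0 0 - 1) by ring]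
    exact (Valuation.map_add _ _ _).trans (max_le hα hud)
  -- TOP-ness: the centred `ϖ^(d₀+1) = ϖ^(2n)`-ball of `B₀`-fixed self-dual lattices is EMPTY (★ part X §1 at `γ₂ := e₂⁻¹B₀`)
  have htop : {B : Submodule (Valued.integer (w.1.adicCompletion L)) (Fin 2 → (w.1.adicCompletion L)) | IsSelfDualLattice (galAdicCompletionMap (L := L) (IsCMField.complexConj L) hw) (ϖ : (w.1.adicCompletion L)) (!![(0 : (w.1.adicCompletion L)), 1; 1, 0] : Matrix (Fin 2) (Fin 2) (w.1.adicCompletion L)) B ∧ mapGL B₀ B = B ∧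
        B.map ((Matrix.toLin' ((B₀ : Matrix (Fin 2) (Fin 2) (w.1.adicCompletion L)) - ((B₀ : Matrix (Fin 2) (Fin 2) (w.1.adicCompletion L)).trace / 2) • (1 : Matrix (Fin 2) (Fin 2) (w.1.adicCompletion L)))).restrictScalars (Valued.integer (w.1.adicCompletion L))) ≤
          scaleLattice ((ϖ : (w.1.adicCompletion L)) ^ (d₀ + 1)) B} = ∅ := by
    have hFfin := finite_selfDual_fixed_of_even_depth_ramified L v w hw he h2 ϖ hϖ hσϖ γ₂ (by rw [heγ]; exact hirr) (n := n) (by rw [heγ]; exact hN) hn1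
    have h0 := ncard_selfDual_fixed_centredBall_top_eq_zero_of_even_depth_ramified L v w hw he h2 ϖ hϖ hσϖ γ₂ (by rw [heγ]; exact hirr) (n := n)
      (by rw [heγ]; exact hN) hn1
    have hempty := (Set.ncard_eq_zero (hFfin.subset fun B hB => ⟨hB.1, hB.2.1⟩)).1 h0
    rw [heγ, ← hH, ← hd] at hempty
    exact hempty
  rw [ncard_rootRegion_not_class_eq_ncard_two_of_top hσ hvσ hϖ h2w γ B₀ u hγ hB₀ hu hud hα htop c₀]
  exact two_mul_ncard_selfDual_fixed_lev_not_class_eq_of_top_of_mem_unitaryGroupOfForm L v w hw he h2 ϖ hϖ hσϖ B₀ hB₀ hirr hN hn1 hd hcD c₀ ε hc₀ hεv hε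

end Literature.NumberTheory.Automorphic.UnitaryGroup

end
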